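import Summits.QuantumFields.YangMills.Theorems.LuscherReductionDressedRitzPlateauDefs
import Summits.QuantumFields.YangMills.Theorems.LuscherReductionDressedRitzPolyakovLiftBlockPosition
import Summits.QuantumFields.YangMills.Theorems.LuscherReductionDressedRitzPolyakovLiftPScalingFamily
import HarnessLib

/-!
# Route `LuscherReduction`, item `DressedRitz` (stmt-QuantumFields-20205) — LEVEL HEREDITY: the level-`k` slice `KTGen.DressedRitzAt k` of the
# route decl is DOWNWARD HEREDITARY in `k`; so is the ∃-text `BlockPositionForL (TransplantBasisLR k)` of skeleton r9 (line «polyakovlift»)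

Prover seat ymfull-r2b-prover-1 (cell ym-gapexp, R590-ym item (10)), `--supports stmt-QuantumFields-20205 --as helper`.

WHAT.  The route decl `Theses.LuscherReduction.DressedRitz` is `∀ k, KTGen.DressedRitzAt k` (`Iff.rfl`, tree `KTGen.dressedRitz_iff_forall_dressedRitzAt`).
This file proves the elementary but so far untyped structural fact that the slices are NESTED:

* ★ `KTGen.dressedRitzAt_of_le : k ≤ k' → DressedRitzAt k' → DressedRitzAt k` — restrict the level-`k'` Ritz family `φ₀ … φ_{k'}` to its first
  `k+1` members (same constants `C, lam0, L0`): physicality, `l2`-orthonormality, `qform`-diagonality, antitone Ritz values, the two-sided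
  product-form position of each `m_j` and the coarse top capture (same `φ₀`) are inherited verbatim; the residual-Gram clause (ii′) for coefficients
  `c : Fin (k+1) → ℝ` is the level-`k'` clause at the ZERO-EXTENDED coefficients (`sum_extend_castLE`, `Σ c'² = Σ c²`).
* `KTGen.dressedRitz_of_cofinal`, ★ `KTGen.dressedRitz_iff_frequently : DressedRitz ↔ ∃ᶠ k in atTop, DressedRitzAt k` — item 20205 is equivalent to
  its slices along ANY cofinal set of levels: a supplier (RG line, or the KT ∕ TT doors of skeleton KTR r8) may fix the level as large as convenient
  (e.g. at the top of a complete `𝔥`-multiplet, where no degenerate partner is cut) and never needs the small-`k` slices separately.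
* r9 registry text (line «polyakovlift», skeleton 8856f38b6809): `PolyakovLift.transplantBasisLR_castLE` (a level-`k'` transplant basis restricts to a
  level-`k` one: `PScal.isEigenFamily_castLE`, same radius) and ★ `PolyakovLift.blockPositionForL_transplantLR_of_le : k ≤ k' →
  BlockPositionForL (TransplantBasisLR k') → BlockPositionForL (TransplantBasisLR k)` — the ∃-basis stub `stub_blockPosition` is likewise downward
  hereditary, so it too may be supplied along a cofinal set of levels.  (The two ∀-basis texts `StaticsForL`, `BlockLeakageForL` quantify over ALL
  level-`k` bases; their heredity would need EXTENSION of AL1 eigenfamilies of `𝔥`, not restriction, and is not claimed here.)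
* Degenerate rows for the record: `PolyakovLift.blockLeakageForL_transplantLR_zero`, `PolyakovLift.blockPositionForL_transplantLR_zero` — the `k = 0`
  rows of the two block stubs hold outright (no channel; the basis predicate is inhabited in the window by `transplantBasisLR_nonempty`), matching
  `KTGen.dressedRitzAt_zero` and `staticsForLR_of_le_one`: the content of all three r9 stubs starts at `k = 1`.

HONEST FRAMING: fixed-lattice bookkeeping on the CONDITIONAL femto rung R2b1 (finite volume); it proves nothing OF `DressedRitz` at any `k ≥ 1`, where
the open renormalisation-group content lives; nothing here bears on infinite volume, the continuum limit or the Clay mass gap — the Yang–Mills mass gap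
is NOT proved.  References: M. Lüscher, NPB 219 (1983) 233 [cite: Luscher1983, §3]; Reed–Simon IV [cite: ReedSimonIV1978, Thm. XIII.1].
-/

set_option autoImplicit false

noncomputable section

open MeasureTheory Filter Topology Real
open Literature.MathematicalPhysics.QuantumFieldTheory
open Literature.MathematicalPhysics.QuantumLattice
open Literature.Analysis.OperatorTheory.YMMatrixModel
open scoped BigOperators

namespace Summit.QuantumFields.YangMills.Theorems.FemtoTransferGap

/-! ## §1 Zero-extension of coefficients along `Fin.castLE` -/

/-- Summing a family `G i' (c' i')` with `G i' 0 = 0` over the ZERO-EXTENSION `c' = Function.extend (Fin.castLE h) c 0` of coefficients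
`c : Fin n → ℝ` to `Fin m` (`n ≤ m`) gives the sum of `G (castLE h i) (c i)` over `Fin n`. [folklore] -/
theorem KTGen.sum_extend_castLE {n m : ℕ} (h : n ≤ m) {M : Type*} [AddCommMonoid M] (c : Fin n → ℝ) (G : Fin m → ℝ → M)
    (hG : ∀ i', G i' 0 = 0) :
    ∑ i', G i' (Function.extend (Fin.castLE h) c 0 i') = ∑ i, G (Fin.castLE h i) (c i) := by
  classical
  have himg : ∑ i, G (Fin.castLE h i) (c i) =
      ∑ x ∈ (Finset.univ : Finset (Fin n)).map (Fin.castLEEmb h), G x (Function.extend (Fin.castLE h) c 0 x) := by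
    rw [Finset.sum_map]
    refine Finset.sum_congr rfl fun i _ => ?_
    have e1 : (Fin.castLEEmb h) i = Fin.castLE h i := rfl
    rw [e1, (Fin.castLE_injective h).extend_apply]
  rw [himg]
  symm
  refine Finset.sum_subset (Finset.subset_univ _) fun x _ hx => ?_
  have hx' : ¬ ∃ a, Fin.castLE h a = x := by
    rintro ⟨a, rfl⟩
    exact hx (Finset.mem_map.mpr ⟨a, Finset.mem_univ _, rfl⟩)
  rw [Function.extend_apply' _ _ _ hx', Pi.zero_apply, hG]

/-! ## §2 ★ Level heredity of the slices of item 20205 -/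

/-- ★ **`DressedRitzAt` is downward hereditary in the level**: `k ≤ k' → DressedRitzAt k' → DressedRitzAt k` (restrict the Ritz family to its first
`k+1` members; same constants; clause (ii′) via zero-extended coefficients). [cite: Luscher1983, §3] -/
theorem KTGen.dressedRitzAt_of_le {k k' : ℕ} (hk : k ≤ k') (h : KTGen.DressedRitzAt k') : KTGen.DressedRitzAt k := by
  intro η hη
  obtain ⟨C, lam0, hlam0, hC⟩ := h η hη
  refine ⟨C, lam0, hlam0, fun lam hlam hle => ?_⟩
  obtain ⟨L0, hL0⟩ := hC lam hlam hle
  refine ⟨L0, fun L _ hL β hW => ?_⟩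
  obtain ⟨φ, hφ, hon, hdiag, hanti, hpos, hres, htop⟩ := hL0 L hL β hW
  have hk1 : k + 1 ≤ k' + 1 := Nat.succ_le_succ hk
  have hι0 : Fin.castLE hk1 0 = 0 := Fin.ext rfl
  refine ⟨fun i => φ (Fin.castLE hk1 i), fun i => hφ _, fun i l => ?_, fun i l hil => ?_, fun i l hil => ?_,
    fun j => ?_, fun c => ?_, fun ψ hψ => ?_⟩
  · -- (b) orthonormality
    rw [hon]
    simp only [Fin.castLE_inj]
  · -- (c) diagonality
    exact hdiag _ _ fun e => hil (Fin.castLE_injective hk1 e)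
  · -- (d) antitone Ritz values
    exact hanti _ _ hil
  · -- (e) two-sided position of `m_j` (same `φ₀`; `(castLE j : ℕ) = j`)
    have hj := hpos (Fin.castLE hk1 j)
    beta_reduce
    rw [hι0]
    exact hj
  · -- (f) residual Gram bound at the zero-extended coefficients
    have key1 : ∑ i', Function.extend (Fin.castLE hk1) c 0 i' •
          (transferApply β (φ i') - qform su2Rep β (φ i') (φ i') • φ i') =
        ∑ i, c i • (transferApply β (φ (Fin.castLE hk1 i)) -
          qform su2Rep β (φ (Fin.castLE hk1 i)) (φ (Fin.castLE hk1 i)) • φ (Fin.castLE hk1 i)) :=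
      KTGen.sum_extend_castLE hk1 c (fun i' t => t • (transferApply β (φ i') - qform su2Rep β (φ i') (φ i') • φ i'))
        fun i' => zero_smul ℝ _
    have key2 : ∑ i', Function.extend (Fin.castLE hk1) c 0 i' ^ 2 = ∑ i, c i ^ 2 :=
      KTGen.sum_extend_castLE hk1 c (fun _ t => t ^ 2) fun _ => by simp
    have hc := hres (Function.extend (Fin.castLE hk1) c 0)
    rw [key1, key2] at hc
    beta_reduce
    rw [hι0]
    exact hc
  · -- (g) coarse top capture (same `φ₀`)
    beta_reduce
    rw [hι0]
    exact htop ψ hψ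

/-- `DressedRitzAt (k+1) → DressedRitzAt k`. [cite: Luscher1983, §3] -/
theorem KTGen.dressedRitzAt_of_succ {k : ℕ} (h : KTGen.DressedRitzAt (k + 1)) : KTGen.DressedRitzAt k :=
  KTGen.dressedRitzAt_of_le (Nat.le_succ k) h

/-- **Cofinal sufficiency**: if every level is dominated by a level where the slice holds, the route decl `DressedRitz` (item 20205) holds BY NAME.
[cite: Luscher1983, §3] -/
theorem KTGen.dressedRitz_of_cofinal (h : ∀ k : ℕ, ∃ k' : ℕ, k ≤ k' ∧ KTGen.DressedRitzAt k') :
    Summit.QuantumFields.YangMills.Theses.LuscherReduction.DressedRitz :=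
  KTGen.dressedRitz_iff_forall_dressedRitzAt.mpr fun k => by
    obtain ⟨k', hk, hk'⟩ := h k
    exact KTGen.dressedRitzAt_of_le hk hk'

/-- ★ **Item 20205 ⟺ its slices hold frequently (i.e. along a cofinal set of levels).** [cite: Luscher1983, §3] -/
theorem KTGen.dressedRitz_iff_frequently :
    Summit.QuantumFields.YangMills.Theses.LuscherReduction.DressedRitz ↔ ∃ᶠ k in atTop, KTGen.DressedRitzAt k := by
  constructor
  · intro h
    exact Filter.Frequently.of_forall (KTGen.dressedRitz_iff_forall_dressedRitzAt.mp h)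
  · intro h
    refine KTGen.dressedRitz_of_cofinal fun k => ?_
    obtain ⟨k', hk', hp⟩ := Filter.frequently_atTop.mp h k
    exact ⟨k', hk', hp⟩

/-- The slices hold at EVERY level iff they hold EVENTUALLY in the level. [cite: Luscher1983, §3] -/
theorem KTGen.dressedRitz_iff_eventually :
    Summit.QuantumFields.YangMills.Theses.LuscherReduction.DressedRitz ↔ ∀ᶠ k in atTop, KTGen.DressedRitzAt k := by
  constructor
  · intro h
    exact Filter.Eventually.of_forall (KTGen.dressedRitz_iff_forall_dressedRitzAt.mp h)
  · intro h
    exact KTGen.dressedRitz_iff_frequently.mpr h.frequently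

end Summit.QuantumFields.YangMills.Theorems.FemtoTransferGap

namespace Summit.QuantumFields.YangMills.Theorems.FemtoTransferGap.PolyakovLift

open Summit.QuantumFields.YangMills.Theorems.FemtoTransferGap

/-! ## §3 Level heredity of the r9 ∃-text `BlockPositionForL (TransplantBasisLR k)` (line «polyakovlift») -/

/-- A level-`k'` transplant basis RESTRICTS to a level-`k` transplant basis (`k ≤ k'`): restrict the AL1 eigenfamily of `𝔥`
(`PScal.isEigenFamily_castLE`), keep the radius; `transplantObsL L Λ R f (castLE i) = transplantObsL L Λ R (f ∘ castLE) i`.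
[cite: ReedSimonIV1978, Thm. XIII.64] [cite: Luscher1983, §2–§3] -/
theorem transplantBasisLR_castLE {k k' L : ℕ} (hk : k ≤ k') {Λ : ℝ} {g : Fin k' → (GaugeConfig 3 1 SU2 → ℝ)}
    (hg : TransplantBasisLR k' L Λ g) : TransplantBasisLR k L Λ fun i => g (Fin.castLE hk i) := by
  obtain ⟨f, R, hf, hpos, hR1, hR4, hRΛ, hgi⟩ := hg
  refine ⟨fun j => f (Fin.castLE (Nat.succ_le_succ hk) j), R, PScal.isEigenFamily_castLE hk hf, fun x => hpos x, hR1, hR4, hRΛ,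
    fun i => ?_⟩
  beta_reduce
  rw [hgi]
  funext U
  have e1 : Fin.castLE (Nat.succ_le_succ hk) i.succ = (Fin.castLE hk i).succ := Fin.ext rfl
  have e0 : Fin.castLE (Nat.succ_le_succ hk) 0 = 0 := Fin.ext rfl
  simp only [transplantObsL, transplantFn]
  rw [e1, e0]

/-- ★ **`BlockPositionForL (TransplantBasisLR k') → BlockPositionForL (TransplantBasisLR k)` for `k ≤ k'`** (the ∃-basis r9 stub text
`stub_blockPosition` is downward hereditary in the level: restrict the basis; (B5)(B6) are clauses channel by channel ∕ pair by pair; same constants).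
[cite: Luscher1983, §3] -/
theorem blockPositionForL_transplantLR_of_le {k k' : ℕ} (hk : k ≤ k') (h : BlockPositionForL (TransplantBasisLR k')) :
    BlockPositionForL (TransplantBasisLR k) := by
  obtain ⟨C, lam0, hC, hlam0, hmain⟩ := h
  refine ⟨C, lam0, hC, hlam0, fun lam hlam hle => ?_⟩
  obtain ⟨L0, hL0⟩ := hmain lam hlam hle
  refine ⟨L0, fun L _ hL β hW φ hφ => ?_⟩
  obtain ⟨g, hg, hB5, hB6⟩ := hL0 L hL β hW φ hφ
  refine ⟨fun i => g (Fin.castLE hk i), transplantBasisLR_castLE hk hg, fun i => ?_, fun i l hil => ?_⟩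
  · exact hB5 (Fin.castLE hk i)
  · exact hB6 (Fin.castLE hk i) (Fin.castLE hk l) fun e => hil (Fin.castLE_injective hk e)

/-- All levels from a cofinal family of levels (∃-text). [cite: Luscher1983, §3] -/
theorem blockPositionForL_transplantLR_of_cofinal (h : ∀ k : ℕ, ∃ k' : ℕ, k ≤ k' ∧ BlockPositionForL (TransplantBasisLR k')) :
    ∀ k : ℕ, BlockPositionForL (TransplantBasisLR k) := fun k => by
  obtain ⟨k', hk, hk'⟩ := h k
  exact blockPositionForL_transplantLR_of_le hk hk'

/-! ## §4 The degenerate rows `k = 0` of the two block stubs (for the record) -/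

/-- `BlockLeakageForL P` at `k = 0` holds for every basis predicate (no channel: `Fin 0` is empty). [folklore] -/
theorem blockLeakageForL_zero (P : ℕ → ℝ → (Fin 0 → (GaugeConfig 3 1 SU2 → ℝ)) → Prop) : BlockLeakageForL P :=
  ⟨0, 1, le_rfl, one_pos, fun _ _ _ => ⟨0, fun _ _ _ _ _ _ _ _ _ i => i.elim0⟩⟩

/-- The `k = 0` row of the r9 stub `stub_blockLeakage` holds outright. [folklore] -/
theorem blockLeakageForL_transplantLR_zero : BlockLeakageForL (TransplantBasisLR 0) :=
  blockLeakageForL_zero _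

/-- `BlockPositionForL P` at `k = 0` holds for every basis predicate INHABITED along the femto window (∃-text: only the basis is asked for).
[folklore] -/
theorem blockPositionForL_zero {P : ℕ → ℝ → (Fin 0 → (GaugeConfig 3 1 SU2 → ℝ)) → Prop} {lam1 : ℝ} (hlam1 : 0 < lam1)
    (hP : ∀ (L : ℕ) (Λ : ℝ), 0 < Λ → Λ ≤ 2 * lam1 → ∃ g, P L Λ g) : BlockPositionForL P := by
  refine ⟨0, lam1, le_rfl, hlam1, fun lam hlam hle => ⟨0, fun L _ _ β hW φ _ => ?_⟩⟩
  obtain ⟨g, hg⟩ := hP L (luscherLambda β L) (luscherLambda_pos_of_window hlam hW) (hW.2.2.trans (by linarith))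
  exact ⟨g, hg, fun i => i.elim0, fun i => i.elim0⟩

/-- The `k = 0` row of the r9 stub `stub_blockPosition` holds outright (`lam0 = 1/16`: in the window `Λ ≤ 2·lam ≤ 1/8`, where
`transplantBasisLR_nonempty` inhabits the basis predicate). [folklore] -/
theorem blockPositionForL_transplantLR_zero : BlockPositionForL (TransplantBasisLR 0) :=
  blockPositionForL_zero (lam1 := 1 / 16) (by norm_num) fun L Λ hΛ hΛle =>
    transplantBasisLR_nonempty 0 L hΛ (hΛle.trans (by norm_num))

end Summit.QuantumFields.YangMills.Theorems.FemtoTransferGap.PolyakovLift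

end
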